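import Summits.ResolutionOfSingularities.ResolutionOfSingularities.Theorems.EquisingularLiftEquisingularLiftNatMarkedTwoStep
import Summits.ResolutionOfSingularities.ResolutionOfSingularities.Theorems.EquisingularLiftEquisingularLiftNatTwoStepVertex
import HarnessLib

/-!
# [OURS] THE MULTI-ROOT TWO-STEP VERTEX: a coordinate vertex of `V₊(F) ⊆ ℙⁿ` whose chart carries MARKED second-order data (exceptional singular
# points anywhere on the exceptional divisor, e.g. `D₄`) is a TWO-STEP point — bricks 6–7 (transports) of the multi-root level-1 bridge
# (✓ …NatMarkedCharts p836016, ✓ …NatMarkedTwoStep; cruxes `Theses.EquisingularLift.EquisingularLiftNat` / `…NatThree` / `EquisingularLift`,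
# stmt-ResolutionOfSingularities-20038 / -20148 / -15660)

[OURS · leafhand-res-equisingularlift-12 g0, 2026-08-31; cell `pub/decomp-res`] AI-produced, weaker than expert review; NOT a statement of any manuscript;
nothing here proves resolution of singularities in positive characteristic.  DEF-FREE helper; no `sorry`; standard axioms; ZERO named hypotheses.

The proofs are those of ✓ `OneStep.twoStepAt_of_affineChart` (p833663) and ✓ `twoStepAt_vertex` (p834097) VERBATIM, with the origin-only second-order data
(`hjac`: «… or `P ⊇ (T)`», `hsec`: splitting of `G_a` at the origin) replaced by MARKED data (`Λ a ⊆ K^{N+1}` finite; `hjac`: «… or `T_i − λ_i ∈ P` for all `i`,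
some `λ ∈ Λ a`»; `hsec`: splitting of the translate `G_a(T + λ)` with one-step data) and the affine input ✓ `OneStep.twoStepAt_origin_marked`:

* ★★ `OneStep.twoStepAt_of_affineChart_marked` — a closed point of ANY scheme hit by an open immersion from `Spec K[y]/(Φ + Ψ)` sending the origin to it is
  a TWO-STEP point under marked second-order data;
* ★★★ `twoStepAt_vertex_marked` — `F` a form of positive degree whose vertex chart `F(x_c := 1) = Φ + Ψ` (radical) carries marked second-order data: the
  point of `V₊(F)` over `P_c` is a closed TWO-STEP point (the clause `htwo` of ✓ `isoHypPoint_of_twoStepPoints` / ✓ `isoHypPoint_of_twoStepVertices`).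

With ✓ `isoHypPoint_of_twoStepPoints` (leafhand-10) / the bookkeeping of ✓ `isoHypPoint_of_twoStepVertices` (p835865) this certifies `IsoHypPoint` for prime
hypersurfaces whose singular vertices are one-step or MARKED two-step, once the polynomial datum is supplied (remaining `D₄` item = the polynomial computation
«`x² + y³ + z³`-type chart: three marks `λ` in one chart, each translate an `A₁` = one-step», S/M).  Honest label: closes no registered stub.

References: [Hartshorne1977, I Thm. 5.1, II Prop. 5.9]; [StacksProject, Tags 0804, 080E]; [GortzWedhorn2020, Prop. 13.91, (13.19)]; through the cited tree files.
-/

set_option linter.dupNamespace false -- mandated namespace `Summit.<Summit>.<Problem>` of this single-conjunct summit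

noncomputable section

open CategoryTheory CategoryTheory.Limits AlgebraicGeometry TopologicalSpace
open Literature.AlgebraicGeometry.Resolution Literature.AlgebraicGeometry.Motives
open AlgebraicGeometry.Scheme.IdealSheafData
open MvPolynomial HomogeneousLocalization
open Literature.AlgebraicGeometry.Motives.SmoothHypersurface Literature.AlgebraicGeometry.Motives.ProjectiveSpace
open Summit.ResolutionOfSingularities.ResolutionOfSingularities.Cruxes.EquisingularLift.StrataSplit

namespace Summit.ResolutionOfSingularities.ResolutionOfSingularities.Cruxes.EquisingularLiftNat.Sections

namespace OneStep

/-- ★★ **TWO-STEP THROUGH AN AFFINE HYPERSURFACE CHART, MARKED DATA**: `ψ : Spec (K[y]/(Φ + Ψ)) → H` an open immersion with `ψ y₀ = x` (`y₀` the origin,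
`x` closed) and the marked second-order data of ✓ `OneStep.twoStepAt_origin_marked` ⟹ `x` is a TWO-STEP point of `H`.  Proof of ✓ `twoStepAt_of_affineChart`
verbatim (✓ `PointChain.twoStepAt_of_iso`, ✓ `PointChain.twoStepAt_of_open`). [OURS] [cite: GortzWedhorn2020, Prop. 13.91, (13.19)] -/
theorem twoStepAt_of_affineChart_marked (K : Type) [Field K] {N : ℕ} (Φ Ψ : MvPolynomial (Fin (N + 1)) K) {μ : ℕ} (hμ : 1 ≤ μ)
    (hΦ : Φ.IsHomogeneous μ) (hΦ0 : Φ ≠ 0)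
    (hΨ : Ψ ∈ Ideal.span (Set.range (X : Fin (N + 1) → MvPolynomial (Fin (N + 1)) K)) ^ (μ + 1))
    (G : Fin (N + 1) → MvPolynomial (Fin (N + 1)) K)
    (hG : ∀ a, aeval (fun j => X a * Function.update (X : Fin (N + 1) → MvPolynomial (Fin (N + 1)) K) a 1 j) (Φ + Ψ) = X a ^ μ * G a)
    (Λ : Fin (N + 1) → Finset (Fin (N + 1) → K))
    (hjac : ∀ a, ∀ P : Ideal (MvPolynomial (Fin (N + 1)) K), P.IsPrime → (X a : MvPolynomial (Fin (N + 1)) K) ∈ P → G a ∈ P →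
      (∃ j, pderiv j (G a) ∉ P) ∨ ∃ lam ∈ Λ a, ∀ i, (X i - C (lam i) : MvPolynomial (Fin (N + 1)) K) ∈ P)
    (hsec : ∀ a, ∀ lam ∈ Λ a, G a ∈ Ideal.span (Set.range fun i : Fin (N + 1) => (X i - C (lam i) : MvPolynomial (Fin (N + 1)) K)) →
      ∃ (μ' : ℕ) (Φ' Ψ' : MvPolynomial (Fin (N + 1)) K), 1 ≤ μ' ∧ Φ'.IsHomogeneous μ' ∧ Φ' ≠ 0 ∧
        Ψ' ∈ Ideal.span (Set.range (X : Fin (N + 1) → MvPolynomial (Fin (N + 1)) K)) ^ (μ' + 1) ∧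
        aeval (fun i => X i + C (lam i)) (G a) = Φ' + Ψ' ∧
        ∀ b : Fin (N + 1), ∃ G' : MvPolynomial (Fin (N + 1)) K,
          aeval (fun j => X b * Function.update (X : Fin (N + 1) → MvPolynomial (Fin (N + 1)) K) b 1 j) (Φ' + Ψ') = X b ^ μ' * G' ∧
          ∀ P : Ideal (MvPolynomial (Fin (N + 1)) K), P.IsPrime → (X b : MvPolynomial (Fin (N + 1)) K) ∈ P → G' ∈ P → ∃ j, pderiv j G' ∉ P)
    (y₀ : Spec (CommRingCat.of (MvPolynomial (Fin (N + 1)) K ⧸ Ideal.span {Φ + Ψ})))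
    (hy₀ : y₀.asIdeal = Ideal.map (Ideal.Quotient.mk (Ideal.span {Φ + Ψ}))
      (Ideal.span (Set.range (X : Fin (N + 1) → MvPolynomial (Fin (N + 1)) K))))
    {H : Scheme.{0}} (ψ : Spec (CommRingCat.of (MvPolynomial (Fin (N + 1)) K ⧸ Ideal.span {Φ + Ψ})) ⟶ H) [IsOpenImmersion ψ]
    {x : H} (hψx : ψ y₀ = x) (hx : IsClosed ({x} : Set H)) :
    ∀ (Z : Scheme.{0}) (τ : Z ⟶ H), IsBlowup τ (vanishingIdeal ⟨{x}, hx⟩) →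
      ∃ S' : Finset Z, (∀ z : Z, τ z = x → z ∉ S' → IsRegularLocalRing (Z.presheaf.stalk z)) ∧
        ∀ z ∈ S', τ z = x ∧ ∃ hz : IsClosed ({z} : Set Z), ∀ (Z' : Scheme.{0}) (τ' : Z' ⟶ Z),
          IsBlowup τ' (vanishingIdeal ⟨{z}, hz⟩) → ∀ z' : Z', τ' z' = z → IsRegularLocalRing (Z'.presheaf.stalk z') := by
  have hmax := isMaximal_map_mk_span_range_X K Φ Ψ hμ hΦ hΨ
  have hy₀cl : IsClosed ({y₀} : Set (Spec (CommRingCat.of (MvPolynomial (Fin (N + 1)) K ⧸ Ideal.span {Φ + Ψ})))) :=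
    (PrimeSpectrum.isClosed_singleton_iff_isMaximal y₀).mpr (hy₀ ▸ hmax)
  have h0 := twoStepAt_origin_marked K Φ Ψ hμ hΦ hΦ0 hΨ G hG Λ hjac hsec y₀ hy₀ hy₀cl
  -- along `ψ = e.hom ≫ U.ι`
  let U : H.Opens := ψ.opensRange
  let e := ψ.isoOpensRange
  have hψU : ∀ w, U.ι (e.hom w) = ψ w := fun w => by
    rw [← Scheme.Hom.comp_apply, Scheme.Hom.isoOpensRange_hom_ι]
  have hxU : x ∈ U := ⟨y₀, hψx⟩
  have hu₀ : U.ι (e.hom y₀) = x := (hψU y₀).trans hψx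
  have hu₀cl : IsClosed ({e.hom y₀} : Set (U : Scheme.{0})) :=
    PointChain.isClosed_singleton_of_injective U.ι U.ι.isOpenEmbedding.injective (by rw [hu₀]; exact hx)
  have h1 := PointChain.twoStepAt_of_iso e hy₀cl h0 hu₀cl
  exact PointChain.twoStepAt_of_open U hxU hx (e.hom y₀) hu₀ hu₀cl h1

end OneStep

set_option maxHeartbeats 800000 in -- as ✓ `twoStepAt_vertex`: chart rings of `Proj` are slow to unify
/-- ★★★ **THE MULTI-ROOT TWO-STEP VERTEX.**  Proof of ✓ `twoStepAt_vertex` verbatim with the marked data. [OURS] [cite: Hartshorne1977, I Thm. 5.1, II Prop. 5.9]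
[cite: StacksProject, Tag 0804] -/
theorem twoStepAt_vertex_marked (K : Type) [Field K] {m : ℕ} (F : MvPolynomial (Fin (m + 2 + 1)) K) {d : ℕ} (hF : F.IsHomogeneous d) (hd : 0 < d)
    (c : Fin (m + 2 + 1)) (Φ Ψ : MvPolynomial (Fin (m + 2)) K) {μ : ℕ} (hμ : 1 ≤ μ) (hΦ : Φ.IsHomogeneous μ) (hΦ0 : Φ ≠ 0)
    (hΨ : Ψ ∈ Ideal.span (Set.range (X : Fin (m + 2) → MvPolynomial (Fin (m + 2)) K)) ^ (μ + 1))
    (hdeh : ProjectiveSpace.dehomogenize K c F = Φ + Ψ) (hrad : (Ideal.span {Φ + Ψ}).radical = Ideal.span {Φ + Ψ})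
    (G : Fin (m + 2) → MvPolynomial (Fin (m + 2)) K)
    (hG : ∀ a, aeval (fun j => X a * Function.update (X : Fin (m + 2) → MvPolynomial (Fin (m + 2)) K) a 1 j) (Φ + Ψ) = X a ^ μ * G a)
    (Λ : Fin (m + 2) → Finset (Fin (m + 2) → K))
    (hjac : ∀ a, ∀ P : Ideal (MvPolynomial (Fin (m + 2)) K), P.IsPrime → (X a : MvPolynomial (Fin (m + 2)) K) ∈ P → G a ∈ P →
      (∃ j, pderiv j (G a) ∉ P) ∨ ∃ lam ∈ Λ a, ∀ i, (X i - C (lam i) : MvPolynomial (Fin (m + 2)) K) ∈ P)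
    (hsec : ∀ a, ∀ lam ∈ Λ a, G a ∈ Ideal.span (Set.range fun i : Fin (m + 2) => (X i - C (lam i) : MvPolynomial (Fin (m + 2)) K)) →
      ∃ (μ' : ℕ) (Φ' Ψ' : MvPolynomial (Fin (m + 2)) K), 1 ≤ μ' ∧ Φ'.IsHomogeneous μ' ∧ Φ' ≠ 0 ∧
        Ψ' ∈ Ideal.span (Set.range (X : Fin (m + 2) → MvPolynomial (Fin (m + 2)) K)) ^ (μ' + 1) ∧
        aeval (fun i => X i + C (lam i)) (G a) = Φ' + Ψ' ∧
        ∀ b : Fin (m + 2), ∃ G' : MvPolynomial (Fin (m + 2)) K,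
          aeval (fun j => X b * Function.update (X : Fin (m + 2) → MvPolynomial (Fin (m + 2)) K) b 1 j) (Φ' + Ψ') = X b ^ μ' * G' ∧
          ∀ P : Ideal (MvPolynomial (Fin (m + 2)) K), P.IsPrime → (X b : MvPolynomial (Fin (m + 2)) K) ∈ P → G' ∈ P → ∃ j, pderiv j G' ∉ P) :
    letI := MvPolynomial.gradedAlgebra (σ := Fin (m + 2 + 1)) (R := K)
    ∃ (x₀ : ↥(hypersurface F).left) (hx₀cl : IsClosed ({x₀} : Set ↥(hypersurface F).left)),
      (∀ a : Fin (m + 2 + 1), a ≠ c → (X a : MvPolynomial (Fin (m + 2 + 1)) K) ∈ ((hypersurfaceι F).left x₀).asHomogeneousIdeal) ∧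
      ∀ (Z : Scheme.{0}) (τ : Z ⟶ (hypersurface F).left), IsBlowup τ (vanishingIdeal ⟨{x₀}, hx₀cl⟩) →
        ∃ S' : Finset Z, (∀ z : Z, τ z = x₀ → z ∉ S' → IsRegularLocalRing (Z.presheaf.stalk z)) ∧
          ∀ z ∈ S', τ z = x₀ ∧ ∃ hz : IsClosed ({z} : Set Z), ∀ (Z' : Scheme.{0}) (τ' : Z' ⟶ Z),
            IsBlowup τ' (vanishingIdeal ⟨{z}, hz⟩) → ∀ z' : Z', τ' z' = z → IsRegularLocalRing (Z'.presheaf.stalk z') := by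
  letI := MvPolynomial.gradedAlgebra (σ := Fin (m + 2 + 1)) (R := K)
  letI := MvPolynomial.gradedAlgebra (σ := Fin (0 + 1)) (R := K)
  letI := ProjBaseChange.algebraBase (R := K) (homogeneousSubmodule (Fin (m + 2 + 1)) K)
    (Submonoid.powers (X c : MvPolynomial (Fin (m + 2 + 1)) K))
  classical
  -- the kill map of the vertex `P_c`
  have he : Function.Injective (fun _ : Fin 1 => c) := Function.injective_of_subsingleton _
  obtain ⟨fk, hfk', hfkC, hfke, hfk0⟩ := LinearCentre.exists_kill (R := K) (fun _ : Fin 1 => c) he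
  have hfke' : ∀ j : Fin 1, fk (X c) = X j := fun j => hfke j
  have hfk0' : ∀ i : Fin (m + 2 + 1), i ≠ c → fk (X i) = 0 := fun i hi => hfk0 i (fun ⟨_, hj⟩ => hi hj.symm)
  -- the vertex point
  obtain ⟨x₀, hx₀cl, hx₀cl', hsupp, hx₀X, hΛ, hcomap⟩ :=
    exists_vertexPoint K F hF c ⟨μ, Φ, Ψ, hμ, hΦ, hΨ, hdeh⟩ fk hfk' hfkC hfke' hfk0'
  refine ⟨x₀, hx₀cl', hx₀X, ?_⟩
  -- the chart `ψ = Spec θ ≫ chart F c`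
  obtain ⟨θ, hθ⟩ := HypersurfaceSpecimen.exists_chartQuotEquiv F hF c (Φ + Ψ) hdeh hrad
  let ψ : Spec (CommRingCat.of (MvPolynomial (Fin (m + 2)) K ⧸ Ideal.span {Φ + Ψ})) ⟶ (hypersurface F).left :=
    Spec.map θ.toCommRingCatIso.hom ≫ (chart F c hF hd).left
  haveI : IsOpenImmersion (Spec.map θ.toCommRingCatIso.hom) := IsOpenImmersion.of_isIso _
  haveI : @IsOpenImmersion (Spec (CommRingCat.of (ChartRing F c hF))) _ (chart F c hF hd).left :=
    isOpenImmersion_chart_left F c hF hd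
  haveI : IsOpenImmersion ψ := IsOpenImmersion.comp _ _
  -- the origin and its image
  let y₀ : Spec (CommRingCat.of (MvPolynomial (Fin (m + 2)) K ⧸ Ideal.span {Φ + Ψ})) :=
    ⟨Ideal.map (Ideal.Quotient.mk (Ideal.span {Φ + Ψ})) (Ideal.span (Set.range (X : Fin (m + 2) → MvPolynomial (Fin (m + 2)) K))),
      (OneStep.isMaximal_map_mk_span_range_X K Φ Ψ hμ hΦ hΨ).isPrime⟩
  have hy₀ : y₀.asIdeal = Ideal.map (Ideal.Quotient.mk (Ideal.span {Φ + Ψ}))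
      (Ideal.span (Set.range (X : Fin (m + 2) → MvPolynomial (Fin (m + 2)) K))) := rfl
  -- the vertex ideal pulled back to the chart is the origin ideal of `ChartRing F c`
  have hchart := HypersurfaceSpecimen.comap_chart_eq_ofIdealTop K F hF hd (fun _ : Fin 1 => c) he fk hfk' hfkC hfke hfk0 c
  -- the origin ideal of `ChartRing F c` goes into the origin ideal of `K[y]/(f)` under `θ`
  have hI₀ : ∀ q ∈ Ideal.span (Set.range fun a : {a : Fin (m + 2 + 1) // a ∉ Set.range (fun _ : Fin 1 => c)} => tautVec F c hF a.1),
      θ q ∈ y₀.asIdeal := by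
    intro q hq
    have hle : Ideal.span (Set.range fun a : {a : Fin (m + 2 + 1) // a ∉ Set.range (fun _ : Fin 1 => c)} => tautVec F c hF a.1) ≤
        y₀.asIdeal.comap θ.toRingHom := by
      rw [Ideal.span_le]
      rintro _ ⟨⟨a, ha⟩, rfl⟩
      obtain ⟨j, hj⟩ : ∃ j : Fin (m + 2), c.succAbove j = a := Fin.exists_succAbove_eq (fun h => ha ⟨0, h.symm⟩)
      rw [SetLike.mem_coe, Ideal.mem_comap]
      change θ (tautVec F c hF a) ∈ y₀.asIdeal
      rw [← hj, hθ j, hy₀]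
      exact Ideal.mem_map_of_mem _ (Ideal.subset_span ⟨j, rfl⟩)
    exact hle hq
  have hψx : ψ y₀ = x₀ := by
    -- the point `p₀ = Spec θ (y₀)` of the chart lies on the pulled-back vertex ideal
    have hsurj : Function.Surjective (Scheme.ΓSpecIso (CommRingCat.of (ChartRing F c hF))).inv :=
      (ConcreteCategory.bijective_of_isIso (C := CommRingCat) (Scheme.ΓSpecIso (CommRingCat.of (ChartRing F c hF))).inv).2
    have hinj : Function.Injective (Scheme.ΓSpecIso (CommRingCat.of (ChartRing F c hF))).inv :=
      (ConcreteCategory.bijective_of_isIso (C := CommRingCat) (Scheme.ΓSpecIso (CommRingCat.of (ChartRing F c hF))).inv).1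
    -- the chart morphism with source typed as `Spec (ChartRing F c)`
    have hchart' : Scheme.IdealSheafData.comap (X := Spec (CommRingCat.of (ChartRing F c hF)))
        (((Proj.map fk hfk').ker.comap (hypersurfaceι F).left)) (chart F c hF hd).left =
        ofIdealTop ((Ideal.span (Set.range fun a : {a : Fin (m + 2 + 1) // a ∉ Set.range (fun _ : Fin 1 => c)} => tautVec F c hF a.1)).map
          (Scheme.ΓSpecIso (CommRingCat.of (ChartRing F c hF))).inv.hom) := hchart
    have hp : Spec.map θ.toCommRingCatIso.hom y₀ ∈
        ((Scheme.IdealSheafData.comap (X := Spec (CommRingCat.of (ChartRing F c hF)))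
          (((Proj.map fk hfk').ker.comap (hypersurfaceι F).left)) (chart F c hF hd).left).support :
            Set (Spec (CommRingCat.of (ChartRing F c hF)))) := by
      rw [hchart', Scheme.IdealSheafData.coe_support_ofIdealTop, Spec_zeroLocus, Spec.map_apply]
      refine (PrimeSpectrum.mem_zeroLocus _ _).mpr ?_
      intro r hr
      obtain ⟨r', hr', hrr'⟩ := (Ideal.mem_map_iff_of_surjective _ hsurj).mp hr
      have hr'' : r = r' := hinj hrr'.symm
      subst hr''
      rw [SetLike.mem_coe, PrimeSpectrum.comap_asIdeal, Ideal.mem_comap]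
      exact hI₀ r hr'
    rw [Scheme.IdealSheafData.support_comap] at hp
    change (chart F c hF hd).left (Spec.map θ.toCommRingCatIso.hom y₀) ∈
      ((((Proj.map fk hfk').ker.comap (hypersurfaceι F).left)).support : Set ↥(hypersurface F).left) at hp
    rw [hcomap, Scheme.IdealSheafData.coe_support_vanishingIdeal] at hp
    exact hp
  exact OneStep.twoStepAt_of_affineChart_marked K Φ Ψ hμ hΦ hΦ0 hΨ G hG Λ hjac hsec y₀ hy₀ ψ hψx hx₀cl'

end Summit.ResolutionOfSingularities.ResolutionOfSingularities.Cruxes.EquisingularLiftNat.Sections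

end
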